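import Literature.MathematicalPhysics.QuantumFieldTheory.YangMillsOS
import Literature.MathematicalPhysics.QuantumLattice.TorusWilsonGibbs
import HarnessLib

/-!
# Markov property of the torus Wilson state across a separating slab, in operator form

For the Wilson lattice gauge theory `μ = wilsonMeasure r.ρ β` on the discrete torus
`(ℤ/(2S+1))⁴` (`ConstructiveQFTWave0.lean`) and the conditional expectations
`P_D := μ[· | cylinderEvents D]` given the link variables in a set `D` of links, this file proves
the operator form of the MARKOV PROPERTY of the nearest-neighbour (plaquette) interaction used by
block-factorisation / bisection arguments for Poincaré and log-Sobolev inequalities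
(Martinelli 1999, §3; Georgii 2011, Rem. 1.24 with (2.11); Friedli–Velenik 2017, §6.3):

* `condExp_wilsonMeasure_markov_slab` — cut a cylinder `Q = {x | ∀ ν, (x ν - a ν).val < n ν}`
  (exterior links `K = {ℓ | ℓ.1 ∉ Q}`) along an INTERVAL direction `i` (`n i ≤ 2S`) by the offset
  `(ℓ.1 i - a i).val` of the base point into `{< p}`, `MID = {p ≤ · < p + w}` (`w ≥ 1`) and
  `HIGH = {≥ p + w}`.  For `B ⊆ HIGH`, `D` disjoint from `HIGH` and a.e. bounded `f`:
  `P_{K ∪ D} P_{K ∪ B} f = P_{K ∪ D} P_{K ∪ MID} P_{K ∪ B} f` a.e.  Proof: the torus Wilson state is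
  a DLR state of the plaquette specification (`isGibbsMeasure_wilsonMeasure`), whose kernel
  `γ_{HIGH}` is a version of `P_{HIGHᶜ}` reading only the links of plaquettes touching `HIGH`
  (`stronglyMeasurable_and_ae_eq_condExp_integral_gibbsSpecOfPotential`); such a plaquette has
  all its links in `HIGH ∪ MID ∪ K` (`le_and_le_mod_of_plaquette`: its base points have
  `i`-offsets `τ` or `τ + 1 (mod 2S+1)`, and no wrap-around occurs on an interval side), so
  `P_{HIGHᶜ} g` has an `𝓕_{K ∪ MID}`-measurable version for bounded `𝓕_{K ∪ B}`-measurable `g`,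
  and the tower property finishes.
* the `L²(μ)` toolkit of the MAXIMAL-CORRELATION calculus `‖P_X P_Z f − P_K f‖₂ ≤ ρ ‖f − P_K f‖₂`
  on an arbitrary finite measure space, in squared-integral form: contraction
  `∫ (P_m h)² ≤ ∫ h²` (`integral_condExp_sq_le_of_ae_bdd`, Mathlib
  `integral_norm_condExp_rpow_le`), the plain bound `‖P_X P_Z f − P_K f‖₂ ≤ ‖f − P_K f‖₂`
  (`maxCorr_sq_le_of_coarse`), MONOTONICITY of the bound under coarsening `X, Z`
  (`maxCorr_sq_le_of_mono`; tower property, contraction, and truncation of the a.e.-bounded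
  `P_{Z'} f` to a bounded measurable version, `exists_stronglyMeasurable_truncation`).

Nothing in the toolkit is specific to Wilson's action (any finite measure).

## References

* F. Martinelli, *Lectures on Glauber dynamics for discrete spin models*, LNM 1717 (1999), §3.
* H.-O. Georgii, *Gibbs Measures and Phase Transitions*, 2nd ed. (de Gruyter 2011), Rem. 1.24,
  (2.11).
* S. Friedli, Y. Velenik, *Statistical Mechanics of Lattice Systems* (CUP 2017), §6.3.
-/

noncomputable section

open MeasureTheory ProbabilityTheory Filter
open Literature.MathematicalPhysics.QuantumFieldTheory

namespace Literature.MathematicalPhysics.QuantumLattice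

/-! ### `L²` toolkit: conditional expectations of bounded functions on a finite measure space -/

section Abstract

variable {Ω : Type*} {m mK mX mX' mM mZ mZ' : MeasurableSpace Ω} {m0 : MeasurableSpace Ω}
  {μ : Measure Ω}

/-- **Truncation**: an `m`-measurable real `h` has an `m`-measurable truncation `g` at height
`|M|`, bounded everywhere by `|M|` and equal to `h` wherever `|h| ≤ M`. [folklore] -/
theorem exists_stronglyMeasurable_truncation {h : Ω → ℝ} (hh : StronglyMeasurable[m] h) (M : ℝ) :
    ∃ g : Ω → ℝ, StronglyMeasurable[m] g ∧ (∀ ω, |g ω| ≤ |M|) ∧ ∀ ω, |h ω| ≤ M → g ω = h ω := by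
  refine ⟨fun ω => max (-|M|) (min |M| (h ω)), ?_, fun ω => ?_, fun ω hω => ?_⟩
  · exact (continuous_const.max (continuous_const.min continuous_id)).comp_stronglyMeasurable hh
  · exact abs_le.2 ⟨le_max_left _ _, max_le (neg_le_self (abs_nonneg M)) (min_le_left _ _)⟩
  · obtain ⟨h1, h2⟩ := abs_le.1 (hω.trans (le_abs_self M))
    simp only
    rw [min_eq_right h2, max_eq_right h1]

/-- Square integrals respect a.e. equality. [folklore] -/
theorem integral_sq_congr_ae {u v : Ω → ℝ} (huv : u =ᵐ[μ] v) :
    ∫ ω, u ω ^ 2 ∂μ = ∫ ω, v ω ^ 2 ∂μ :=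
  integral_congr_ae (huv.mono fun ω hω => by simp only [hω])

/-- An a.e. bound for a difference of a.e. bounded functions. [folklore] -/
theorem ae_abs_sub_le_add {u v : Ω → ℝ} {M M' : ℝ} (hu : ∀ᵐ ω ∂μ, |u ω| ≤ M)
    (hv : ∀ᵐ ω ∂μ, |v ω| ≤ M') : ∀ᵐ ω ∂μ, |u ω - v ω| ≤ M + M' := by
  filter_upwards [hu, hv] with ω h1 h2
  exact (abs_sub _ _).trans (add_le_add h1 h2)

variable [IsFiniteMeasure μ]

/-- An a.e. bounded a.e. strongly measurable real function on a finite measure space is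
integrable. [folklore] -/
theorem integrable_of_ae_bdd_abs {h : Ω → ℝ} (hh : AEStronglyMeasurable h μ) {M : ℝ}
    (hb : ∀ᵐ ω ∂μ, |h ω| ≤ M) : Integrable h μ :=
  Integrable.of_bound hh M (hb.mono fun ω hω => by rwa [Real.norm_eq_abs])

/-- Its square is integrable as well. [folklore] -/
theorem integrable_sq_of_ae_bdd_abs {h : Ω → ℝ} (hh : AEStronglyMeasurable h μ) {M : ℝ}
    (hb : ∀ᵐ ω ∂μ, |h ω| ≤ M) : Integrable (fun ω => h ω ^ 2) μ := by
  refine Integrable.of_bound (hh.pow 2) (M ^ 2) (hb.mono fun ω hω => ?_)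
  simp only [Real.norm_eq_abs, abs_pow]
  exact pow_le_pow_left₀ (abs_nonneg _) hω 2

/-- **Conditional expectation is a contraction of `L²`**: `∫ (P_m h)² ≤ ∫ h²` for a.e. bounded
`h` (conditional Jensen; Mathlib `integral_norm_condExp_rpow_le` with `p = 2`). [folklore] -/
theorem integral_condExp_sq_le_of_ae_bdd {h : Ω → ℝ} (hh : AEStronglyMeasurable h μ)
    {M : ℝ} (hb : ∀ᵐ ω ∂μ, |h ω| ≤ M) :
    ∫ ω, (μ[h|m]) ω ^ 2 ∂μ ≤ ∫ ω, h ω ^ 2 ∂μ := by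
  have hint : Integrable (fun ω => ‖h ω‖ ^ (2 : ℝ)) μ := by
    refine (integrable_sq_of_ae_bdd_abs hh hb).congr (ae_of_all _ fun ω => ?_)
    simp only [Real.rpow_two, Real.norm_eq_abs, sq_abs]
  have := integral_norm_condExp_rpow_le (m := m) (μ := μ) (f := h) one_le_two hint
  simpa only [Real.rpow_two, Real.norm_eq_abs, sq_abs] using this

/-- Linearity against a coarser conditional expectation: for `mK ≤ m`,
`P_m (A - P_K f) = P_m A - P_K f` a.e. [folklore] -/
theorem condExp_sub_condExp_of_le (hKm : mK ≤ m) (hm : m ≤ m0)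
    {A : Ω → ℝ} (hA : Integrable A μ) (f : Ω → ℝ) :
    μ[fun ω => A ω - (μ[f|mK]) ω | m] =ᵐ[μ] fun ω => (μ[A|m]) ω - (μ[f|mK]) ω := by
  have h1 : μ[μ[f|mK] | m] = μ[f|mK] :=
    condExp_of_stronglyMeasurable hm (stronglyMeasurable_condExp.mono hKm) integrable_condExp
  have h2 := condExp_sub hA (integrable_condExp (m := mK) (μ := μ) (f := f)) m
  rw [h1] at h2
  exact h2

/-- **Double contraction**: for `mK ≤ mX, mZ`, `‖P_X P_Z f - P_K f‖₂ ≤ ‖f - P_K f‖₂`, since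
`P_X P_Z f - P_K f = P_X P_Z (f - P_K f)`. [folklore] -/
theorem maxCorr_sq_le_of_coarse (hX : mX ≤ m0) (hZ : mZ ≤ m0) (hKX : mK ≤ mX)
    (hKZ : mK ≤ mZ) {f : Ω → ℝ} (hf : AEStronglyMeasurable f μ) {M : ℝ}
    (hb : ∀ᵐ ω ∂μ, |f ω| ≤ M) :
    ∫ ω, ((μ[μ[f|mZ]|mX]) ω - (μ[f|mK]) ω) ^ 2 ∂μ ≤ ∫ ω, (f ω - (μ[f|mK]) ω) ^ 2 ∂μ := by
  have hfi : Integrable f μ := integrable_of_ae_bdd_abs hf hb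
  have hvb : ∀ᵐ ω ∂μ, |f ω - (μ[f|mK]) ω| ≤ M + M :=
    ae_abs_sub_le_add hb (ae_bdd_abs_condExp_of_ae_bdd_abs hb)
  have hvm : AEStronglyMeasurable (fun ω => f ω - (μ[f|mK]) ω) μ :=
    hf.sub integrable_condExp.aestronglyMeasurable
  have h1 : μ[fun ω => f ω - (μ[f|mK]) ω | mZ] =ᵐ[μ] fun ω => (μ[f|mZ]) ω - (μ[f|mK]) ω :=
    condExp_sub_condExp_of_le hKZ hZ hfi f
  have h2 : μ[μ[fun ω => f ω - (μ[f|mK]) ω | mZ] | mX] =ᵐ[μ]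
      fun ω => (μ[μ[f|mZ]|mX]) ω - (μ[f|mK]) ω :=
    (condExp_congr_ae h1).trans (condExp_sub_condExp_of_le hKX hX integrable_condExp f)
  rw [← integral_sq_congr_ae h2]
  refine (integral_condExp_sq_le_of_ae_bdd integrable_condExp.aestronglyMeasurable
    (ae_bdd_abs_condExp_of_ae_bdd_abs hvb)).trans ?_
  exact integral_condExp_sq_le_of_ae_bdd hvm hvb

/-- Degenerate case: `‖P_X P_K f - P_K f‖₂ = 0` for `mK ≤ mX`. [folklore] -/
theorem maxCorr_sq_eq_zero_of_coarse (hX : mX ≤ m0) (hKX : mK ≤ mX) (f : Ω → ℝ) :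
    ∫ ω, ((μ[μ[f|mK]|mX]) ω - (μ[f|mK]) ω) ^ 2 ∂μ = 0 := by
  rw [condExp_of_stronglyMeasurable hX (stronglyMeasurable_condExp.mono hKX) integrable_condExp]
  simp

/-- **Monotonicity of the maximal-correlation bound.** If `‖P_X P_Z h - P_K h‖₂ ≤ ρ ‖h - P_K h‖₂`
for all bounded measurable `h`, then the same bound holds with `X, Z` replaced by coarser
`mK ≤ mX' ≤ mX`, `mK ≤ mZ' ≤ mZ`, for every a.e. bounded `f`: with `h := P_{Z'} f` (truncated to
a bounded measurable version), `P_{X'} P_{Z'} f - P_K f = P_{X'} (P_X P_Z h - P_K h)` and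
`h - P_K h = P_{Z'} (f - P_K f)`, and `P_{X'}`, `P_{Z'}` are contractions. [folklore] -/
theorem maxCorr_sq_le_of_mono (hX : mX ≤ m0) (hX' : mX' ≤ m0)
    (hZ : mZ ≤ m0) (hZ' : mZ' ≤ m0)
    (hKX' : mK ≤ mX') (hX'X : mX' ≤ mX) (hKZ' : mK ≤ mZ') (hZ'Z : mZ' ≤ mZ) {ρ : ℝ}
    (H : ∀ h : Ω → ℝ, Measurable h → (∃ M : ℝ, ∀ ω, |h ω| ≤ M) →
      ∫ ω, ((μ[μ[h|mZ]|mX]) ω - (μ[h|mK]) ω) ^ 2 ∂μ ≤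
        ρ ^ 2 * ∫ ω, (h ω - (μ[h|mK]) ω) ^ 2 ∂μ)
    {f : Ω → ℝ} (hf : AEStronglyMeasurable f μ) {M : ℝ} (hb : ∀ᵐ ω ∂μ, |f ω| ≤ M) :
    ∫ ω, ((μ[μ[f|mZ']|mX']) ω - (μ[f|mK]) ω) ^ 2 ∂μ ≤
      ρ ^ 2 * ∫ ω, (f ω - (μ[f|mK]) ω) ^ 2 ∂μ := by
  have hfi : Integrable f μ := integrable_of_ae_bdd_abs hf hb
  -- `h₀ := P_{Z'} f` and its truncation `g`
  have h0m : StronglyMeasurable[mZ'] (μ[f|mZ']) := stronglyMeasurable_condExp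
  have h0b : ∀ᵐ ω ∂μ, |(μ[f|mZ']) ω| ≤ M := ae_bdd_abs_condExp_of_ae_bdd_abs hb
  obtain ⟨g, hgm, hgb, hg⟩ := exists_stronglyMeasurable_truncation h0m M
  have hg' : g =ᵐ[μ] μ[f|mZ'] := h0b.mono fun ω hω => hg ω hω
  have Hg := H g (hgm.mono hZ').measurable ⟨|M|, hgb⟩
  -- identify the pieces of `Hg`
  have h1 : μ[g|mZ] =ᵐ[μ] μ[f|mZ'] := (condExp_congr_ae hg').trans
    (by rw [condExp_of_stronglyMeasurable hZ (h0m.mono hZ'Z) integrable_condExp])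
  have h3 : μ[g|mK] =ᵐ[μ] μ[f|mK] := (condExp_congr_ae hg').trans (condExp_condExp_of_le hKZ' hZ')
  have hL : (fun ω => (μ[μ[g|mZ]|mX]) ω - (μ[g|mK]) ω) =ᵐ[μ]
      fun ω => (μ[μ[f|mZ']|mX]) ω - (μ[f|mK]) ω := (condExp_congr_ae h1).sub h3
  have hR : (fun ω => g ω - (μ[g|mK]) ω) =ᵐ[μ] fun ω => (μ[f|mZ']) ω - (μ[f|mK]) ω := hg'.sub h3
  rw [integral_sq_congr_ae hL, integral_sq_congr_ae hR] at Hg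
  -- the left side: `P_{X'} P_{Z'} f - P_K f = P_{X'} (P_X P_{Z'} f - P_K f)`
  have h4 : μ[fun ω => (μ[μ[f|mZ']|mX]) ω - (μ[f|mK]) ω | mX'] =ᵐ[μ]
      fun ω => (μ[μ[f|mZ']|mX']) ω - (μ[f|mK]) ω :=
    (condExp_sub_condExp_of_le hKX' hX' integrable_condExp f).trans
      ((condExp_condExp_of_le hX'X hX).sub EventuallyEq.rfl)
  have hub : ∀ᵐ ω ∂μ, |(μ[μ[f|mZ']|mX]) ω - (μ[f|mK]) ω| ≤ M + M :=
    ae_abs_sub_le_add (ae_bdd_abs_condExp_of_ae_bdd_abs h0b) (ae_bdd_abs_condExp_of_ae_bdd_abs hb)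
  have hum : AEStronglyMeasurable (fun ω => (μ[μ[f|mZ']|mX]) ω - (μ[f|mK]) ω) μ :=
    integrable_condExp.aestronglyMeasurable.sub integrable_condExp.aestronglyMeasurable
  -- the right side: `P_{Z'} f - P_K f = P_{Z'} (f - P_K f)`
  have h5 : μ[fun ω => f ω - (μ[f|mK]) ω | mZ'] =ᵐ[μ] fun ω => (μ[f|mZ']) ω - (μ[f|mK]) ω :=
    condExp_sub_condExp_of_le hKZ' hZ' hfi f
  have hvb : ∀ᵐ ω ∂μ, |f ω - (μ[f|mK]) ω| ≤ M + M :=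
    ae_abs_sub_le_add hb (ae_bdd_abs_condExp_of_ae_bdd_abs hb)
  have hvm : AEStronglyMeasurable (fun ω => f ω - (μ[f|mK]) ω) μ :=
    hf.sub integrable_condExp.aestronglyMeasurable
  calc ∫ ω, ((μ[μ[f|mZ']|mX']) ω - (μ[f|mK]) ω) ^ 2 ∂μ
      = ∫ ω, (μ[fun ω => (μ[μ[f|mZ']|mX]) ω - (μ[f|mK]) ω | mX']) ω ^ 2 ∂μ :=
        (integral_sq_congr_ae h4).symm
    _ ≤ ∫ ω, ((μ[μ[f|mZ']|mX]) ω - (μ[f|mK]) ω) ^ 2 ∂μ := integral_condExp_sq_le_of_ae_bdd hum hub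
    _ ≤ ρ ^ 2 * ∫ ω, ((μ[f|mZ']) ω - (μ[f|mK]) ω) ^ 2 ∂μ := Hg
    _ = ρ ^ 2 * ∫ ω, (μ[fun ω => f ω - (μ[f|mK]) ω | mZ']) ω ^ 2 ∂μ := by
        rw [integral_sq_congr_ae h5]
    _ ≤ ρ ^ 2 * ∫ ω, (f ω - (μ[f|mK]) ω) ^ 2 ∂μ :=
        mul_le_mul_of_nonneg_left (integral_condExp_sq_le_of_ae_bdd hvm hvb) (sq_nonneg ρ)

end Abstract

/-! ### The Markov property of the torus Wilson measure across a separating slab -/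

section Markov

open Literature.Probability.LatticeModels (gibbsSpecOfPotential IsGibbsMeasure
  isSpecification_gibbsSpecOfPotential)
-- adapted from Literature/Probability/LatticeModels/ReflectionPositivityExtension.lean
/-- A `cylinderEvents Δ`-measurable real observable depends only on the coordinates in `Δ`
(it factors through the restriction to `Δ`; Mathlib `Measurable.factorsThrough`). [folklore] -/
theorem dependsOn_of_measurable_cylinderEvents_real {V S : Type*} [MeasurableSpace S] {Δ : Set V}
    {F : (V → S) → ℝ} (hF : Measurable[cylinderEvents (X := fun _ : V => S) Δ] F) :
    DependsOn F Δ := by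
  have hle : cylinderEvents (X := fun _ : V => S) Δ ≤
      MeasurableSpace.comap (Set.restrict Δ) MeasurableSpace.pi := by
    refine iSup₂_le fun i hi => ?_
    have : (fun σ : V → S => σ i) = (fun η : Δ → S => η ⟨i, hi⟩) ∘ Set.restrict Δ := rfl
    rw [this, ← MeasurableSpace.comap_comp]
    exact MeasurableSpace.comap_mono (measurable_pi_apply _).comap_le
  exact dependsOn_iff_factorsThrough.2 (hF.mono hle le_rfl).factorsThrough

/-- **Plaquette geometry, arithmetic core.** On a ring of `L` sites let a plaquette have base
offsets `τ` and `(τ + 1) % L`; if one of its links sits at an offset `v` with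
`p + w ≤ v < nI` (`w ≥ 1`, `nI + 1 ≤ L`: the side is an interval, no wrap-around), then both
base offsets are `≥ p`. [folklore] -/
theorem le_and_le_mod_of_plaquette {τ L p w nI v : ℕ} (hτ : τ < L) (hw : 1 ≤ w)
    (hn : nI + 1 ≤ L) (hv : v = τ ∨ v = (τ + 1) % L) (hpv : p + w ≤ v) (hvn : v < nI) :
    p ≤ τ ∧ p ≤ (τ + 1) % L := by
  rcases Nat.lt_or_ge (τ + 1) L with h | h
  · rw [Nat.mod_eq_of_lt h] at hv ⊢
    omega
  · obtain rfl : L = τ + 1 := le_antisymm h (Nat.succ_le_of_lt hτ)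
    rw [Nat.mod_self] at hv ⊢
    omega

/-- The `i`-offset of the shifted site `y + e_k` is that of `y`, or its successor mod `L`.
[folklore] -/
theorem val_shift_apply_sub_eq_or {L : ℕ} [NeZero L] (y : Site 4 L) (k i : Fin 4) (a : ZMod L) :
    ((y.shift k) i - a).val = (y i - a).val ∨
      ((y.shift k) i - a).val = ((y i - a).val + 1) % L := by
  simp only [Site.shift, Pi.add_apply, Pi.single_apply]
  by_cases h : i = k
  · right
    rw [if_pos h, add_sub_right_comm, ZMod.val_add, ZMod.val_one_eq_one_mod, Nat.add_mod_mod]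
  · left
    rw [if_neg h, add_zero]

variable {G : Type} [Group G] [TopologicalSpace G] [IsTopologicalGroup G] [CompactSpace G]
  [MeasurableSpace G] [BorelSpace G]

/-- **Markov property of the torus Wilson measure in operator form** (Georgii 2011 Rem. 1.24
with (2.11); Friedli–Velenik 2017 §6.3). Let `μ = wilsonMeasure r.ρ β` on the torus of side
`2S+1`, `Q = {x | ∀ ν, (x ν - a ν).val < n ν}` a cylinder with exterior links
`K = {ℓ | ℓ.1 ∉ Q}`, `i` a direction whose side is an interval (`n i ≤ 2S`), and cut the links
of `Q` by their offset `(ℓ.1 i - a i).val` into `{< p}`, `MID = {p ≤ · < p + w}` (`w ≥ 1`) and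
`HIGH = {≥ p + w}`. For `B ⊆ HIGH`, `D` disjoint from `HIGH` and an a.e. bounded `f`,
`P_{K ∪ D} P_{K ∪ B} f = P_{K ∪ D} P_{K ∪ MID} P_{K ∪ B} f` a.e. (`P_E := μ[· | cylinderEvents E]`):
the DLR kernel `γ_{HIGH}` of the plaquette specification is a version of `P_{HIGHᶜ}` that
reads only links of plaquettes touching `HIGH`, all of which lie in `HIGH ∪ MID ∪ K`.
[folklore] -/
theorem condExp_wilsonMeasure_markov_slab (r : LatticeRep G) (β : ℝ) (S : ℕ)
    (μ : Measure (GaugeConfig 4 (2 * S + 1) G))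
    (hμ : μ = (wilsonMeasure r.ρ β : Measure (GaugeConfig 4 (2 * S + 1) G)))
    (a : Fin 4 → ZMod (2 * S + 1)) (n : Fin 4 → ℕ) (i : Fin 4) (hni : n i ≤ 2 * S)
    (p w : ℕ) (hw : 1 ≤ w)
    (Q : Set (Site 4 (2 * S + 1))) (hQ : Q = {x | ∀ ν, (x ν - a ν).val < n ν})
    (K : Set (Edge 4 (2 * S + 1))) (hK : K = {ℓ | ℓ.1 ∉ Q})
    (Mid : Set (Edge 4 (2 * S + 1)))
    (hMid : Mid = {ℓ | ℓ.1 ∈ Q ∧ p ≤ (ℓ.1 i - a i).val ∧ (ℓ.1 i - a i).val < p + w})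
    {B D : Set (Edge 4 (2 * S + 1))}
    (hB : B ⊆ {ℓ | ℓ.1 ∈ Q ∧ p + w ≤ (ℓ.1 i - a i).val})
    (hD : D ⊆ {ℓ | ℓ.1 ∈ Q → (ℓ.1 i - a i).val < p + w})
    {f : GaugeConfig 4 (2 * S + 1) G → ℝ} {M : ℝ} (hb : ∀ᵐ U ∂μ, |f U| ≤ M) :
    μ[μ[f | cylinderEvents (K ∪ B)] | cylinderEvents (K ∪ D)] =ᵐ[μ]
      μ[μ[μ[f | cylinderEvents (K ∪ B)] | cylinderEvents (K ∪ Mid)] | cylinderEvents (K ∪ D)] := by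
  classical
  haveI : SecondCountableTopology G :=
    (r.continuous.isClosedEmbedding r.injective).isEmbedding.secondCountableTopology
  haveI : T2Space G := (r.continuous.isClosedEmbedding r.injective).isEmbedding.t2Space
  haveI : IsProbabilityMeasure μ :=
    hμ ▸ isProbabilityMeasure_wilsonMeasure (d := 4) (L := 2 * S + 1) r.ρ r.continuous β
  obtain ⟨Φ, supp, hΦ, hΦb, hsupp, hH, hstruct⟩ :=
    exists_plaquettePotential (d := 4) (L := 2 * S + 1) r.ρ r.continuous
  have hGibbs : IsGibbsMeasure (gibbsSpecOfPotential (haarProbability G) Φ supp β) μ :=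
    hμ ▸ isGibbsMeasure_wilsonMeasure r.ρ r.continuous hΦ hΦb hsupp hH β
  have hγ := isSpecification_gibbsSpecOfPotential (haarProbability G) hΦ hΦb hsupp β
  -- the volume `Λ = HIGH` and the inclusions
  set High : Set (Edge 4 (2 * S + 1)) := {ℓ | ℓ.1 ∈ Q ∧ p + w ≤ (ℓ.1 i - a i).val} with hHigh
  set Λ : Finset (Edge 4 (2 * S + 1)) := (Set.toFinite High).toFinset with hΛ
  have hΛc : (↑Λ : Set (Edge 4 (2 * S + 1))) = High := Set.Finite.coe_toFinset _
  have hKD : K ∪ D ⊆ (↑Λ : Set (Edge 4 (2 * S + 1)))ᶜ := by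
    rw [hΛc]
    rintro ℓ (hℓ | hℓ) ⟨hQℓ, hpℓ⟩
    · exact (hK ▸ hℓ : ℓ ∈ {ℓ : Edge 4 (2 * S + 1) | ℓ.1 ∉ Q}) hQℓ
    · exact absurd hpℓ (not_le.2 (hD hℓ hQℓ))
  have hKMid : K ∪ Mid ⊆ (↑Λ : Set (Edge 4 (2 * S + 1)))ᶜ := by
    rw [hΛc]
    rintro ℓ (hℓ | hℓ) ⟨hQℓ, hpℓ⟩
    · exact (hK ▸ hℓ : ℓ ∈ {ℓ : Edge 4 (2 * S + 1) | ℓ.1 ∉ Q}) hQℓ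
    · rw [hMid] at hℓ
      exact absurd hpℓ (not_le.2 hℓ.2.2)
  have hKB : K ∪ B ⊆ ↑Λ ∪ (K ∪ Mid) := by
    rw [hΛc]
    rintro ℓ (hℓ | hℓ)
    · exact Or.inr (Or.inl hℓ)
    · exact Or.inl (hB hℓ)
  -- geometry: a plaquette meeting `HIGH` lies in `HIGH ∪ K ∪ MID`
  have hT : ∀ A ∈ supp Λ, (A ∩ Λ).Nonempty →
      (↑A : Set (Edge 4 (2 * S + 1))) ⊆ ↑Λ ∪ (K ∪ Mid) := by
    intro A hA hne
    obtain ⟨y, i', j', -, rfl⟩ := hstruct Λ A hA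
    obtain ⟨e₀, he₀⟩ := hne
    rw [Finset.mem_inter] at he₀
    have he₀H : e₀ ∈ High := by rw [← hΛc]; exact Finset.mem_coe.2 he₀.2
    have hbase : ∀ e ∈ ({(y, i'), (y.shift i', j'), (y.shift j', i'), (y, j')} :
        Finset (Edge 4 (2 * S + 1))),
        (e.1 i - a i).val = (y i - a i).val ∨
          (e.1 i - a i).val = ((y i - a i).val + 1) % (2 * S + 1) := by
      intro e he
      simp only [Finset.mem_insert, Finset.mem_singleton] at he
      rcases he with rfl | rfl | rfl | rfl
      · exact Or.inl rfl
      · exact val_shift_apply_sub_eq_or y i' i (a i)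
      · exact val_shift_apply_sub_eq_or y j' i (a i)
      · exact Or.inl rfl
    have hQe₀ : ∀ ν, (e₀.1 ν - a ν).val < n ν := by
      have := he₀H.1; rw [hQ] at this; exact this
    obtain ⟨hp1, hp2⟩ := le_and_le_mod_of_plaquette (ZMod.val_lt (y i - a i)) hw
      (by omega : n i + 1 ≤ 2 * S + 1) (hbase e₀ he₀.1) he₀H.2 (hQe₀ i)
    intro e he
    rw [hΛc]
    by_cases hQe : e.1 ∈ Q
    · have hpe : p ≤ (e.1 i - a i).val := by
        rcases hbase e he with h | h
        · rw [h]; exact hp1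
        · rw [h]; exact hp2
      by_cases hhi : p + w ≤ (e.1 i - a i).val
      · exact Or.inl ⟨hQe, hhi⟩
      · refine Or.inr (Or.inr ?_)
        rw [hMid]
        exact ⟨hQe, hpe, not_le.1 hhi⟩
    · refine Or.inr (Or.inl ?_)
      rw [hK]
      exact hQe
  -- the observable `g`: a bounded version of `P_{K ∪ B} f`, `𝓕_{K ∪ B}`-measurable
  have hgm : StronglyMeasurable[cylinderEvents (K ∪ B)] (μ[f | cylinderEvents (K ∪ B)]) :=
    stronglyMeasurable_condExp
  have hgb : ∀ᵐ U ∂μ, |(μ[f | cylinderEvents (K ∪ B)]) U| ≤ M :=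
    ae_bdd_abs_condExp_of_ae_bdd_abs hb
  obtain ⟨g, hgsm, hgbd, hgeq⟩ := exists_stronglyMeasurable_truncation hgm M
  have hgae : g =ᵐ[μ] μ[f | cylinderEvents (K ∪ B)] := hgb.mono fun U hU => hgeq U hU
  have hgmeas : Measurable g := (hgsm.mono cylinderEvents_le_pi).measurable
  have hgdep : DependsOn g (↑Λ ∪ (K ∪ Mid)) :=
    (dependsOn_of_measurable_cylinderEvents_real hgsm.measurable).mono hKB
  obtain ⟨hwm, hwae⟩ := stronglyMeasurable_and_ae_eq_condExp_integral_gibbsSpecOfPotential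
    (haarProbability G) hΦ hΦb hsupp β hGibbs Λ hT hgmeas hgbd hgdep
  -- the kernel average is bounded, hence integrable
  have hwb : ∀ η, |∫ σ, g σ ∂(gibbsSpecOfPotential (haarProbability G) Φ supp β Λ η)| ≤ |M| := by
    intro η
    haveI := hγ.isProbability Λ η
    have := norm_integral_le_of_norm_le_const
      (μ := gibbsSpecOfPotential (haarProbability G) Φ supp β Λ η) (f := g) (C := |M|)
      (ae_of_all _ fun σ => by rw [Real.norm_eq_abs]; exact hgbd σ)
    simpa only [probReal_univ, mul_one, Real.norm_eq_abs] using this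
  have hwi : Integrable (fun η => ∫ σ, g σ ∂(gibbsSpecOfPotential (haarProbability G) Φ supp β Λ η)) μ :=
    Integrable.of_bound (hwm.mono cylinderEvents_le_pi).aestronglyMeasurable |M|
      (ae_of_all _ fun η => by rw [Real.norm_eq_abs]; exact hwb η)
  -- chain of versions
  calc μ[μ[f | cylinderEvents (K ∪ B)] | cylinderEvents (K ∪ D)]
      =ᵐ[μ] μ[g | cylinderEvents (K ∪ D)] := condExp_congr_ae hgae.symm
    _ =ᵐ[μ] μ[μ[g | cylinderEvents (↑Λ : Set (Edge 4 (2 * S + 1)))ᶜ] | cylinderEvents (K ∪ D)] :=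
        (condExp_condExp_of_le (cylinderEvents_mono hKD) cylinderEvents_le_pi).symm
    _ =ᵐ[μ] μ[(fun η => ∫ σ, g σ ∂(gibbsSpecOfPotential (haarProbability G) Φ supp β Λ η)) |
          cylinderEvents (K ∪ D)] := condExp_congr_ae hwae.symm
    _ = μ[μ[(fun η => ∫ σ, g σ ∂(gibbsSpecOfPotential (haarProbability G) Φ supp β Λ η)) |
          cylinderEvents (K ∪ Mid)] | cylinderEvents (K ∪ D)] := by
        rw [condExp_of_stronglyMeasurable cylinderEvents_le_pi hwm hwi]
    _ =ᵐ[μ] μ[μ[μ[g | cylinderEvents (↑Λ : Set (Edge 4 (2 * S + 1)))ᶜ] |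
          cylinderEvents (K ∪ Mid)] | cylinderEvents (K ∪ D)] :=
        condExp_congr_ae (condExp_congr_ae hwae)
    _ =ᵐ[μ] μ[μ[g | cylinderEvents (K ∪ Mid)] | cylinderEvents (K ∪ D)] :=
        condExp_congr_ae (condExp_condExp_of_le (cylinderEvents_mono hKMid) cylinderEvents_le_pi)
    _ =ᵐ[μ] μ[μ[μ[f | cylinderEvents (K ∪ B)] | cylinderEvents (K ∪ Mid)] |
          cylinderEvents (K ∪ D)] := condExp_congr_ae (condExp_congr_ae hgae)

end Markov

end Literature.MathematicalPhysics.QuantumLattice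

end
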